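import Summits.NavierStokesRegularity.NavierStokesRegularity.Theorems.TypeILiouvilleTypeIliouvilleLOseenGauge
import Summits.NavierStokesRegularity.NavierStokesRegularity.Theorems.TypeILiouvilleTypeIliouvilleLStubOseenConstBoost
import Summits.NavierStokesRegularity.NavierStokesRegularity.Theorems.TypeILiouvilleTypeIliouvilleLStubOseenL3ModConstPropagation
import Summits.NavierStokesRegularity.NavierStokesRegularity.Theorems.TypeILiouvilleTypeIliouvilleLStubTypeIRegimeOfKnssGauge
import Literature.Analysis.FluidPDE.AncientL3BackwardLiouvilleHolds
import Literature.Analysis.FluidPDE.TypeIAncientMild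
import HarnessLib

/-!
# Backward-`L³` Liouville in the duality-form class, the Type-I regime from (L') in the KNSS gauge,
# and (L) from its two open halves (crux `TypeIliouvilleL`, stmt-NavierStokesRegularity-10661)

Support file for the crux `TypeIliouvilleL` (= the KNSS Liouville conjecture (L) over the tree's
duality-form class), line `registered`. With the Oseen gauge theorem
(`oseen_gauge_of_aestronglyMeasurable`, sibling file) the whole tree-work of the line closes:

* `liouville_slices_of_backward_L3` — **(L) under far-past `L³` recurrence to constants**: a
  bounded ancient mild solution (`ν = 1`, duality form, a.e.-strongly measurable slices) which is
  `L³`-close (`≤ M`) to spatial constants `b(τ_k)` along some `τ_k → −∞` is a.e. constant on EVERY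
  slice `t < 0`. Proof: gauge `u(t) = v(t, · − A(t)) + c(t)`; the `L³` data become
  `v(τ_k) − d_k ∈ L³` with norm `≤ M` (translation invariance); the constants `d_k` coincide
  (`L³` modulo a constant propagates forward, landed `stub_oseen_L3_modConst_propagation`, and a
  nonzero constant is not in `L³(ℝ³)`); the constant Galilean boost by `d` (landed
  `stub_oseen_const_boost`) is bounded in `L³` along `τ_k`, so Albritton–Barker 2019 Thm 1.2
  (`Literature.Analysis.FluidPDE.AlbrittonBarker2019_liouville_L3_backward_holds`, discharged in
  the tree) makes it vanish: `v ≡ d` and every slice of `u` is a.e. constant.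
* `typeI_regime_liouville_of_knssGauge` — **the Type-I regime of (L) from (L') in the KNSS
  gauge**: if every jointly smooth Oseen-mild ancient field with the Type-I bound
  `‖u(t,x)‖ ≤ C/√(−t)` vanishes (VERBATIM the open item
  `Summit.NavierStokesRegularity.NavierStokesRegularity.Theses.SymmetryModuliCount.TypeIAncientLiouville`,
  stmt-NavierStokesRegularity-4050, `Iff.rfl`; also `ExtremalTypeIConstant.TypeIAncientLiouville`),
  then every bounded ancient mild solution of the duality-form class with Type-I time decay on its
  slices is a.e. constant on every slice (landed `stub_typeI_regime_of_knssGauge` fed with the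
  gauge theorem and conservation of momentum).
* `TypeIliouvilleL_of_knssGauge_of_persistentL3` — **the crux from its two open halves**: (L')
  in the KNSS gauge and far-past `L³` recurrence to constants in the persistent (non-Type-I)
  regime together imply `TypeIliouvilleL` (kernel-checked; the two hypotheses are the registered
  open stubs `stub_typeIAncientLiouville_knssGauge`, `stub_persistent_backward_L3_decay` of the
  line's skeleton).

## References

* G. Koch, N. Nadirashvili, G. Seregin, V. Šverák, Acta Math. 203 (2009) = arXiv:0709.3599, §1
  (conjecture (L), parasitic solutions), §4 (i)–(ii). [KochNadirashviliSereginSverak2009]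
* D. Albritton, T. Barker, J. Math. Fluid Mech. 21 (2019) = arXiv:1811.00502, Thm 1.1, Thm 1.2.
  [AlbrittonBarker2019]
-/

-- the summit and its single problem share the name (D-0017 nested layout)
set_option linter.dupNamespace false

noncomputable section

open MeasureTheory Filter Set Function Metric
open scoped Topology ENNReal

namespace Summit.NavierStokesRegularity.NavierStokesRegularity.Theorems

namespace TypeIliouvilleL.BackwardL3

/-- A constant field on `ℝ³` lies in `L³` only if it vanishes (Lebesgue measure of `ℝ³` is
infinite). -/
theorem const_eq_zero_of_memLp_three {d : EuclideanSpace ℝ (Fin 3)}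
    (h : MemLp (fun _ : EuclideanSpace ℝ (Fin 3) => d) 3 (volume : Measure (EuclideanSpace ℝ (Fin 3)))) :
    d = 0 := by
  rcases (memLp_const_iff (by norm_num) (by norm_num)).1 h with h0 | hμ
  · exact h0
  · rw [measure_univ_of_isAddLeftInvariant] at hμ
    exact absurd hμ (lt_irrefl _)

/-- Two constants `c₁, c₂` with `f − c₁ ∈ L³(ℝ³)` and `f − c₂ ∈ L³(ℝ³)` coincide. -/
theorem const_eq_of_memLp_sub {f : EuclideanSpace ℝ (Fin 3) → EuclideanSpace ℝ (Fin 3)}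
    {c₁ c₂ : EuclideanSpace ℝ (Fin 3)}
    (h₁ : MemLp (fun x => f x - c₁) 3 (volume : Measure (EuclideanSpace ℝ (Fin 3))))
    (h₂ : MemLp (fun x => f x - c₂) 3 (volume : Measure (EuclideanSpace ℝ (Fin 3)))) : c₁ = c₂ := by
  have h : MemLp (fun _ : EuclideanSpace ℝ (Fin 3) => c₂ - c₁) 3
      (volume : Measure (EuclideanSpace ℝ (Fin 3))) := by
    refine (h₁.sub h₂).congr_norm aestronglyMeasurable_const (Eventually.of_forall fun x => ?_)
    simp [sub_sub_sub_cancel_left]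
  exact (sub_eq_zero.1 (const_eq_zero_of_memLp_three h)).symm

/-- `L³` seminorms on `ℝ³` are invariant under the translation `x ↦ x − a` of the argument, for
continuous integrands (Lebesgue measure is translation invariant). -/
theorem eLpNorm_comp_sub_const {g : EuclideanSpace ℝ (Fin 3) → EuclideanSpace ℝ (Fin 3)}
    (hg : Continuous g) (a : EuclideanSpace ℝ (Fin 3)) :
    eLpNorm (fun x => g (x - a)) 3 (volume : Measure (EuclideanSpace ℝ (Fin 3))) =
      eLpNorm g 3 (volume : Measure (EuclideanSpace ℝ (Fin 3))) :=
  eLpNorm_comp_measurePreserving (p := (3 : ENNReal)) hg.aestronglyMeasurable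
    (measurePreserving_sub_right (volume : Measure (EuclideanSpace ℝ (Fin 3))) a)

/-- `L³` seminorms on `ℝ³` are invariant under the translation `x ↦ x + a` of the argument, for
continuous integrands. -/
theorem eLpNorm_comp_add_const {g : EuclideanSpace ℝ (Fin 3) → EuclideanSpace ℝ (Fin 3)}
    (hg : Continuous g) (a : EuclideanSpace ℝ (Fin 3)) :
    eLpNorm (fun x => g (x + a)) 3 (volume : Measure (EuclideanSpace ℝ (Fin 3))) =
      eLpNorm g 3 (volume : Measure (EuclideanSpace ℝ (Fin 3))) :=
  eLpNorm_comp_measurePreserving (p := (3 : ENNReal)) hg.aestronglyMeasurable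
    (measurePreserving_add_right (volume : Measure (EuclideanSpace ℝ (Fin 3))) a)

end TypeIliouvilleL.BackwardL3

open TypeIliouvilleL.BackwardL3 in
/-- **(L) under far-past `L³` recurrence to constants (backward-`L³` Liouville in the duality-form
class).** Let `u` be a bounded ancient mild solution of Navier–Stokes (`ν = 1`, duality form) on
`ℝ³ × (−∞,0)` with a.e.-strongly measurable slices, and suppose there are constants `b(τ_k)`,
times `τ_k < 0` with `τ_k → −∞` and `M < ∞` with `‖u(τ_k) − b(τ_k)‖_{L³} ≤ M` for all `k`. Then
every slice `u(t)`, `t < 0`, is a.e. equal to a constant. (Oseen gauge theorem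
`oseen_gauge_of_aestronglyMeasurable` + `L³`-propagation modulo constants
`stub_oseen_L3_modConst_propagation` + constant boost `stub_oseen_const_boost` +
Albritton–Barker 2019 Thm 1.2 `AlbrittonBarker2019_liouville_L3_backward_holds`; see the module
docstring.) -/
theorem liouville_slices_of_backward_L3 :
    ∀ u : ℝ → EuclideanSpace ℝ (Fin 3) → EuclideanSpace ℝ (Fin 3),
      Literature.Analysis.FluidPDE.IsBoundedAncientMildSolution 1 u →
      (∀ t < 0, AEStronglyMeasurable (u t) volume) →
      (∃ (b : ℝ → EuclideanSpace ℝ (Fin 3)) (τ : ℕ → ℝ) (M : NNReal),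
          (∀ k, τ k < 0) ∧ Tendsto τ atTop atBot ∧
          ∀ k, eLpNorm (fun x => u (τ k) x - b (τ k)) 3
            (volume : Measure (EuclideanSpace ℝ (Fin 3))) ≤ (M : ENNReal)) →
      ∀ t < 0, ∃ b : EuclideanSpace ℝ (Fin 3), u t =ᵐ[volume] fun _ => b := by
  intro u hu hmeas hL3
  obtain ⟨bd, τ, M, hτ0, hτlim, hL3⟩ := hL3
  obtain ⟨v, A, c, -, hvc, hvK, hvd, hvm, -, hrep⟩ := oseen_gauge_of_aestronglyMeasurable u hu hmeas
  -- the `L³` information in the Oseen frame: `v (τ k) − d k ∈ L³` with norm `≤ M`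
  set d : ℕ → EuclideanSpace ℝ (Fin 3) := fun k => bd (τ k) - c (τ k) with hd_def
  have hvcont : ∀ k, Continuous (v (τ k)) := fun k =>
    hvc.comp_continuous (Continuous.prodMk_right (τ k)) fun x => mem_prod.2 ⟨hτ0 k, mem_univ x⟩
  have hL3v : ∀ k, eLpNorm (fun y => v (τ k) y - d k) 3
      (volume : Measure (EuclideanSpace ℝ (Fin 3))) ≤ M := by
    intro k
    have hae : (fun x => u (τ k) x - bd (τ k)) =ᵐ[volume]
        fun x => v (τ k) (x - A (τ k)) - d k := by
      filter_upwards [hrep (τ k) (hτ0 k)] with x hx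
      simp only [hx, hd_def]
      abel
    rw [← eLpNorm_comp_sub_const (g := fun y => v (τ k) y - d k)
      ((hvcont k).sub continuous_const) (A (τ k)), ← eLpNorm_congr_ae hae]
    exact hL3 k
  have hmemv : ∀ k, MemLp (fun y => v (τ k) y - d k) 3
      (volume : Measure (EuclideanSpace ℝ (Fin 3))) := fun k =>
    ⟨((hvcont k).sub continuous_const).aestronglyMeasurable, (hL3v k).trans_lt ENNReal.coe_lt_top⟩
  -- the constants agree
  have hdeq : ∀ k, d k = d 0 := by
    intro k
    rcases lt_trichotomy (τ k) (τ 0) with hlt | heq | hgt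
    · exact const_eq_of_memLp_sub
        (stub_oseen_L3_modConst_propagation v (d k) (τ k) (τ 0) hlt (hτ0 0) hvc hvK hvd hvm (hmemv k))
        (hmemv 0)
    · have h1 : MemLp (fun y => v (τ 0) y - d k) 3 (volume : Measure (EuclideanSpace ℝ (Fin 3))) := by
        have := hmemv k
        rwa [heq] at this
      exact const_eq_of_memLp_sub h1 (hmemv 0)
    · exact (const_eq_of_memLp_sub
        (stub_oseen_L3_modConst_propagation v (d 0) (τ 0) (τ k) hgt (hτ0 k) hvc hvK hvd hvm (hmemv 0))
        (hmemv k)).symm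
  -- the boosted field
  set e : EuclideanSpace ℝ (Fin 3) := d 0 with he_def
  set w : ℝ → EuclideanSpace ℝ (Fin 3) → EuclideanSpace ℝ (Fin 3) := fun t y => v t (y + t • e) - e
    with hw_def
  obtain ⟨hwc, hwK, hwd, hwm⟩ := stub_oseen_const_boost v e hvc hvK hvd hvm
  -- its `L³` norms along `τ k`
  have hwL3 : ∀ k, eLpNorm (w (τ k)) 3 (volume : Measure (EuclideanSpace ℝ (Fin 3))) ≤ M := by
    intro k
    show eLpNorm (fun y => v (τ k) (y + τ k • e) - e) 3 (volume : Measure (EuclideanSpace ℝ (Fin 3))) ≤ M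
    rw [eLpNorm_comp_add_const (g := fun y => v (τ k) y - e) ((hvcont k).sub continuous_const) _]
    have h2 := hL3v k
    rwa [hdeq k] at h2
  -- Albritton–Barker: `w ≡ 0`, hence `v ≡ e`
  have hw0 : ∀ t < 0, ∀ x, w t x = 0 :=
    Literature.Analysis.FluidPDE.AlbrittonBarker2019_liouville_L3_backward_holds hwc hwK hwd hwm
      ⟨τ, (M : ENNReal), ENNReal.coe_lt_top, hτlim, hτ0, hwL3⟩
  have hve : ∀ t < 0, ∀ z, v t z = e := by
    intro t ht z
    have h := hw0 t ht (z - t • e)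
    simp only [hw_def, sub_add_cancel, sub_eq_zero] at h
    exact h
  -- every slice of `u` is a.e. constant
  intro t ht
  refine ⟨e + c t, ?_⟩
  filter_upwards [hrep t ht] with x hx
  rw [hx, hve _ ht]

/-- **The Type-I regime of (L) from (L') in the KNSS gauge.** If every field on `(−∞,0) × ℝ³`
which is jointly smooth, has divergence-free slices, solves the Oseen integral equation
`u(t) = e^{(t−s)Δ}u(s) − B¹_s(u,u)(t)` (written out with the tree's `oseenKernel`) and obeys the
Type-I bound `‖u(t,x)‖ ≤ C/√(−t)` vanishes identically — VERBATIM (`Iff.rfl`) the open item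
`Summit.NavierStokesRegularity.NavierStokesRegularity.Theses.SymmetryModuliCount.TypeIAncientLiouville`
(stmt-NavierStokesRegularity-4050; equivalently `∀ C u, IsTypeIAncientMild C u → u ≡ 0`) — then
every bounded ancient mild solution of the duality-form class (a.e.-strongly measurable slices)
with the Type-I time decay `‖u(t,x)‖ ≤ C/√(−t)` for a.e. `x`, every `t < 0`, is a.e. constant on
every slice. (Landed `stub_typeI_regime_of_knssGauge` fed with the Oseen gauge theorem and
conservation of momentum at infinity.) -/
theorem typeI_regime_liouville_of_knssGauge :
    (∀ (C : ℝ) (u : ℝ → EuclideanSpace ℝ (Fin 3) → EuclideanSpace ℝ (Fin 3)),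
      ContDiffOn ℝ (⊤ : ℕ∞) (Function.uncurry u) (Set.Iio 0 ×ˢ Set.univ) ∧
      (∀ t < 0, Literature.Analysis.FluidPDE.VectorCalculus.IsDivFree (u t)) ∧
      (∀ s t : ℝ, s < t → t < 0 → ∀ x,
        u t x = Literature.Analysis.FluidPDE.heatFlow (u s) (t - s) x -
          ∫ τ in Set.Ioo s t, ∫ y,
            Literature.Analysis.FluidPDE.oseenKernel (t - τ) (x - y) (u τ y) (u τ y)) ∧
      Literature.Analysis.FluidPDE.HasTypeITimeDecay C u →
      ∀ t < 0, ∀ x, u t x = 0) →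
    ∀ u : ℝ → EuclideanSpace ℝ (Fin 3) → EuclideanSpace ℝ (Fin 3),
      Literature.Analysis.FluidPDE.IsBoundedAncientMildSolution 1 u →
      (∀ t < 0, AEStronglyMeasurable (u t) volume) →
      (∃ C : ℝ, ∀ t < 0, ∀ᵐ x ∂(volume : Measure (EuclideanSpace ℝ (Fin 3))),
          ‖u t x‖ ≤ C / Real.sqrt (-t)) →
      ∀ t < 0, ∃ b : EuclideanSpace ℝ (Fin 3), u t =ᵐ[volume] fun _ => b :=
  fun hL' => stub_typeI_regime_of_knssGauge oseen_gauge_of_aestronglyMeasurable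
    stub_oseen_ball_average_momentum hL'

/-- **The crux `TypeIliouvilleL` (= the KNSS Liouville conjecture (L)) from its two open halves:**
(i) (L') in the KNSS gauge (the open item `SymmetryModuliCount.TypeIAncientLiouville`,
stmt-NavierStokesRegularity-4050, verbatim) and (ii) far-past `L³` recurrence to constants for
every bounded ancient mild solution of the duality-form class OUTSIDE the Type-I time regime (open;
it contains `L³`-decay to a constant for bounded steady flows in `ℝ³`, KNSS 2009 p. 3). Split a
bounded ancient mild solution on the Type-I regime: in it, `typeI_regime_liouville_of_knssGauge`;
outside it, (ii) feeds `liouville_slices_of_backward_L3`. Kernel-checked reduction; the two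
hypotheses are exactly the two research-sized stubs of the line's registered skeleton. -/
theorem TypeIliouvilleL_of_knssGauge_of_persistentL3 :
    (∀ (C : ℝ) (u : ℝ → EuclideanSpace ℝ (Fin 3) → EuclideanSpace ℝ (Fin 3)),
      ContDiffOn ℝ (⊤ : ℕ∞) (Function.uncurry u) (Set.Iio 0 ×ˢ Set.univ) ∧
      (∀ t < 0, Literature.Analysis.FluidPDE.VectorCalculus.IsDivFree (u t)) ∧
      (∀ s t : ℝ, s < t → t < 0 → ∀ x,
        u t x = Literature.Analysis.FluidPDE.heatFlow (u s) (t - s) x -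
          ∫ τ in Set.Ioo s t, ∫ y,
            Literature.Analysis.FluidPDE.oseenKernel (t - τ) (x - y) (u τ y) (u τ y)) ∧
      Literature.Analysis.FluidPDE.HasTypeITimeDecay C u →
      ∀ t < 0, ∀ x, u t x = 0) →
    (∀ u : ℝ → EuclideanSpace ℝ (Fin 3) → EuclideanSpace ℝ (Fin 3),
      Literature.Analysis.FluidPDE.IsBoundedAncientMildSolution 1 u →
      (∀ t < 0, AEStronglyMeasurable (u t) volume) →
      (¬ ∃ C : ℝ, ∀ t < 0, ∀ᵐ x ∂(volume : Measure (EuclideanSpace ℝ (Fin 3))),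
          ‖u t x‖ ≤ C / Real.sqrt (-t)) →
      ∃ (b : ℝ → EuclideanSpace ℝ (Fin 3)) (τ : ℕ → ℝ) (M : NNReal),
          (∀ k, τ k < 0) ∧ Tendsto τ atTop atBot ∧
          ∀ k, eLpNorm (fun x => u (τ k) x - b (τ k)) 3
            (volume : Measure (EuclideanSpace ℝ (Fin 3))) ≤ (M : ENNReal)) →
    Summit.NavierStokesRegularity.NavierStokesRegularity.Theses.TypeILiouville.TypeIliouvilleL := by
  intro hL' hS3 u hu hmeas
  by_cases hreg : ∃ C : ℝ, ∀ t < 0, ∀ᵐ x ∂(volume : Measure (EuclideanSpace ℝ (Fin 3))),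
      ‖u t x‖ ≤ C / Real.sqrt (-t)
  · exact typeI_regime_liouville_of_knssGauge hL' u hu hmeas hreg
  · exact liouville_slices_of_backward_L3 u hu hmeas (hS3 u hu hmeas hreg)

end Summit.NavierStokesRegularity.NavierStokesRegularity.Theorems
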